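import Summits.RiemannHypothesis.RiemannHypothesis.Theses.DeBrangesShift
import Literature.Barriers.RiemannHypothesis.DeBrangesPositivityHE
import Literature.Analysis.DeBrangesSpaces.Basic

/-!
# STRATEGY CENSUS (typed) — decomposition attempts for the RESTATED deciding crux
`ShiftPositivity` (stmt-RiemannHypothesis-1517) of route `DeBrangesShift`

Companion of `STRATEGY-CENSUS.md` (same directory) (crux-strategist seat, 2026-08-17). Every candidate split
`X₁ ∧ … ∧ X_k → ShiftPositivity` considered is TYPED here, its (trivial) assembly proved, and the
in-tree facts that kill a piece are recorded as theorems. Nothing here is filed as an item.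
-/

namespace Summit.RiemannHypothesis.RiemannHypothesis.Cruxes.ShiftPositivity.Census

open Complex MeasureTheory
open Summit.RiemannHypothesis.RiemannHypothesis.Theses.DeBrangesShift

noncomputable section

local notation "ξ" => Literature.NumberTheory.LFunctions.riemannXi

/-! ## The crux, unfolded per scale -/

/-- de Branges structure function at scale `c`: `E_c(z) = ξ(1/2 + c − 2icz)`. -/
def E (c : ℝ) : ℂ → ℂ := fun z => ξ (1 / 2 + c - 2 * c * Complex.I * z)

/-- Conrey–Li (2.1) membership in `𝓗(E_c)` — verbatim the route's inlined `Mem`. -/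
def Mem (c : ℝ) (F : ℂ → ℂ) : Prop :=
  Differentiable ℂ F ∧ Integrable (fun x : ℝ => ‖F x / E c x‖ ^ 2) ∧
    ∀ z : ℂ, z.im ≠ 0 → ‖F z‖ ^ 2 ≤ (∫ x : ℝ, ‖F x / E c x‖ ^ 2) *
      ((‖E c z‖ ^ 2 - ‖E c (starRingEnd ℂ z)‖ ^ 2) / (4 * Real.pi * z.im))

/-- de Branges' axiom (3.1) for `𝓗(E_c)` at ONE scale `c`. -/
def PositivityAt (c : ℝ) : Prop :=
  ∀ F : ℂ → ℂ, Mem c F → Mem c (fun z => F (z + Complex.I)) →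
    0 ≤ (∫ x : ℝ, F x * starRingEnd ℂ (F (x + Complex.I)) / ((‖E c x‖ : ℂ) ^ 2)).re

/-- The Conrey–Li kernel test at scale `c` (body of `KernelTestSomeScale`). -/
def KernelTestAt (c : ℝ) : Prop :=
  ∀ ρ : ℂ, ξ ρ = 0 → 0 ≤ (starRingEnd ℂ (deriv ξ ρ) * ξ (ρ + 2 * c)).re

/-- The ratio test at scale `c` (body of `RatioTestSomeScale`): `Re ξ(s+2c)/ξ(s) ≥ 0` on `Re s > 1/2`. -/
def RatioPosAt (c : ℝ) : Prop :=
  ∀ s : ℂ, 1 / 2 < s.re → 0 ≤ (ξ (s + 2 * c) / ξ s).re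

theorem shiftPositivity_iff : ShiftPositivity ↔ ∃ c : ℝ, 1 / 2 ≤ c ∧ PositivityAt c := Iff.rfl

theorem kernelTestSomeScale_iff : KernelTestSomeScale ↔ ∃ c : ℝ, 1 / 2 ≤ c ∧ KernelTestAt c :=
  Iff.rfl

theorem kernelNecessity_iff :
    KernelNecessity ↔ ∀ c : ℝ, 1 / 2 ≤ c → PositivityAt c → KernelTestAt c := Iff.rfl

/-! ## In-tree deaths at the scale c = 1/2 (de Branges' own E = ξ(1 − iz)) -/

/-- The kernel test fails at `c = 1/2` (Conrey–Li (3.2), zero 34; kernel-checked certificate in tree). -/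
theorem kernelTestAt_half_false : ¬ KernelTestAt (1 / 2) := by
  intro h
  obtain ⟨ρ, hρ, -, -, -, hneg⟩ := Literature.Barriers.RiemannHypothesis.ConreyLi2000_HE_holds
  have h1 := h ρ hρ
  have e : ρ + 2 * ((1 / 2 : ℝ) : ℂ) = 1 + ρ := by push_cast; ring
  rw [e] at h1
  linarith

/-- The ratio test fails at `c = 1/2` (Sarnak's Bohr remark, Γ-free proof in tree). -/
theorem ratioPosAt_half_false : ¬ RatioPosAt (1 / 2) := by
  intro h
  apply Literature.Barriers.RiemannHypothesis.ConreyLi2000_FW.not_necessary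
    Literature.Barriers.RiemannHypothesis.ConreyLi2000_FW_holds
  intro s hs
  have h1 := h s hs
  have e : s + 2 * ((1 / 2 : ℝ) : ℂ) = s + 1 := by push_cast; ring
  rw [e] at h1
  exact h1

/-- Hence positivity (3.1) itself fails at `c = 1/2`, given the route's support item
`KernelNecessity` (Conrey–Li Thm 1, 2nd conclusion — `conreyLi2000_thm1_holds` in tree; the
composition with the hypotheses of `E_{1/2}` is item stmt-RiemannHypothesis-1522). -/
theorem positivityAt_half_false (hN : KernelNecessity) : ¬ PositivityAt (1 / 2) := fun h =>
  kernelTestAt_half_false ((kernelNecessity_iff.mp hN) (1 / 2) (by norm_num) h)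

/-! ## D2 — ratio bridge (de Branges' Theorem-2 / 𝓕(W_c) line) -/

/-- D2 piece 1: the ratio test passes at some scale `c ≥ 1/2`. EXPECTED FALSE at every `c`
(Bohr–Kronecker; `c = 1/2` refuted in tree: `ratioPosAt_half_false`). -/
def RatioPosSomeScale : Prop := ∃ c : ℝ, 1 / 2 ≤ c ∧ RatioPosAt c

/-- D2 piece 2: de Branges-type sufficiency — ratio positivity at scale `c` gives (3.1) for `𝓗(E_c)`
(through (3.3) for `𝓕(W_c)`, `W_c = 1/E_c`, and the isometric inclusion `𝓗(E_c) ⊂ 𝓕(W_c)`). -/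
def RatioSufficiency : Prop := ∀ c : ℝ, 1 / 2 ≤ c → RatioPosAt c → PositivityAt c

theorem D2_assembly (h₁ : RatioPosSomeScale) (h₂ : RatioSufficiency) : ShiftPositivity := by
  obtain ⟨c, hc, hr⟩ := h₁
  exact ⟨c, hc, h₂ c hc hr⟩

/-! ## D3 — kernel bridge (Conrey–Li kernel test as the substantive half) -/

/-- D3 piece 2: kernel sufficiency — passing the kernel test at every zero gives (3.1) for all `F`.
No theorem behind it (the kernels `K_c(w_n,·)` at the zeros are neither orthogonal nor known to be a
core for the shift form); its only available proof is VACUITY through `¬KernelTestSomeScale`. -/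
def KernelSufficiency : Prop := ∀ c : ℝ, 1 / 2 ≤ c → KernelTestAt c → PositivityAt c

/-- D3 piece 1 is the route's existing rank-2 crux `KernelTestSomeScale` (stmt-RiemannHypothesis-1518). -/
theorem D3_assembly (h₁ : KernelTestSomeScale) (h₂ : KernelSufficiency) : ShiftPositivity := by
  obtain ⟨c, hc, hk⟩ := h₁
  exact ⟨c, hc, h₂ c hc hk⟩

/-- D3 is an honest equivalence GIVEN the in-tree necessity: `X ↔ X₁ ∧ X₂` fails only because
`KernelSufficiency` quantifies over all `c`; what holds is the pointwise form. -/
theorem D3_converse_pointwise (hN : KernelNecessity) {c : ℝ} (hc : 1 / 2 ≤ c) (h : PositivityAt c) :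
    KernelTestAt c ∧ (KernelTestAt c → PositivityAt c) :=
  ⟨(kernelNecessity_iff.mp hN) c hc h, fun _ => h⟩

/-! ## D4 — dense-subclass split (positivity on the kernel span + closure) -/

/-- Finite linear combinations of reproducing kernels `K_c(w, ·)`, `Im w ≠ 0`, of `𝓗(E_c)`. -/
def kernelSpan (c : ℝ) : Submodule ℂ (ℂ → ℂ) :=
  Submodule.span ℂ (Set.range fun w : {w : ℂ // w.im ≠ 0} =>
    Literature.Analysis.DeBrangesSpaces.deBrangesKernel (E c) (w : ℂ))

/-- D4 piece 1: (3.1) at some scale, but only for `F` in the kernel span. Still EXPECTED FALSE: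
it contains the kernel test (take `F = K_c(w,·)`, `w` a zero of `E_c`). -/
def SpanPositivitySomeScale : Prop :=
  ∃ c : ℝ, 1 / 2 ≤ c ∧ ∀ F : ℂ → ℂ, F ∈ kernelSpan c → Mem c F → Mem c (fun z => F (z + Complex.I)) →
    0 ≤ (∫ x : ℝ, F x * starRingEnd ℂ (F (x + Complex.I)) / ((‖E c x‖ : ℂ) ^ 2)).re

/-- D4 piece 2: closure — positivity on the kernel span extends to the whole form domain. -/
def SpanExtension : Prop :=
  ∀ c : ℝ, 1 / 2 ≤ c →
    (∀ F : ℂ → ℂ, F ∈ kernelSpan c → Mem c F → Mem c (fun z => F (z + Complex.I)) →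
      0 ≤ (∫ x : ℝ, F x * starRingEnd ℂ (F (x + Complex.I)) / ((‖E c x‖ : ℂ) ^ 2)).re) →
    PositivityAt c

theorem D4_assembly (h₁ : SpanPositivitySomeScale) (h₂ : SpanExtension) : ShiftPositivity := by
  obtain ⟨c, hc, hs⟩ := h₁
  exact ⟨c, hc, h₂ c hc hs⟩

/-! ## D5 — RH bridge (an RH-equivalent as the substantive half) -/

/-- D5 piece 2: `RH → ShiftPositivity`. EXPECTED FALSE (ShiftPositivity fails unconditionally at
every scanned scale while RH is expected true); and piece 1 = the summit itself, so (c) fails. -/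
def RHBridge : Prop := Summit.RiemannHypothesis → ShiftPositivity

theorem D5_assembly (h₁ : Summit.RiemannHypothesis) (h₂ : RHBridge) : ShiftPositivity := h₂ h₁

/-! ## D6 — regime restriction (compact scale range) -/

/-- D6: positivity at some scale of the first octave. A SUB-CASE (k = 1), not a decomposition. -/
def PositivityFirstOctave : Prop := ∃ c : ℝ, 1 / 2 ≤ c ∧ c ≤ 1 ∧ PositivityAt c

theorem D6_assembly (h : PositivityFirstOctave) : ShiftPositivity := by
  obtain ⟨c, hc, -, hp⟩ := h
  exact ⟨c, hc, hp⟩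

/-! ## D7 — necessity bridge `KernelNecessity ∧ (KernelNecessity → X)` -/

/-- D7 piece 2. Since `KernelNecessity` is TRUE (in tree up to composition), this piece is `X` again. -/
def NecessityBridge : Prop := KernelNecessity → ShiftPositivity

theorem D7_assembly (h₁ : KernelNecessity) (h₂ : NecessityBridge) : ShiftPositivity := h₂ h₁

/-! ## Strengthen — S⁺ candidates (all dead in tree at c = 1/2) -/

/-- S⁺₁: positivity at EVERY scale `c ≥ 1/2` (de Branges 1992's family claim). -/
def PositivityAllScales : Prop := ∀ c : ℝ, 1 / 2 ≤ c → PositivityAt c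

theorem positivityAllScales_false (hN : KernelNecessity) : ¬ PositivityAllScales := fun h =>
  positivityAt_half_false hN (h (1 / 2) le_rfl)

theorem shiftPositivity_of_allScales (h : PositivityAllScales) : ShiftPositivity :=
  ⟨1 / 2, le_rfl, h (1 / 2) le_rfl⟩

/-- S⁺₂: the kernel test at EVERY scale `c ≥ 1/2` — dead at `c = 1/2` outright. -/
def KernelTestAllScales : Prop := ∀ c : ℝ, 1 / 2 ≤ c → KernelTestAt c

theorem kernelTestAllScales_false : ¬ KernelTestAllScales := fun h =>
  kernelTestAt_half_false (h (1 / 2) le_rfl)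

/-! ## Negation — the route's actual programme, typed -/

/-- `¬X` needs a failing zero at EVERY scale `c ≥ 1/2` (the wanted negation of crux #2). -/
def NegUniform : Prop :=
  ∀ c : ℝ, 1 / 2 ≤ c → ∃ ρ : ℂ, ξ ρ = 0 ∧ (starRingEnd ℂ (deriv ξ ρ) * ξ (ρ + 2 * c)).re < 0

theorem not_kernelTestSomeScale_of (hneg : NegUniform) : ¬ KernelTestSomeScale := by
  rintro ⟨c, hc, hk⟩
  obtain ⟨ρ, hρ, hlt⟩ := hneg c hc
  have := hk ρ hρ
  linarith

theorem not_shiftPositivity_of (hN : KernelNecessity) (hneg : NegUniform) : ¬ ShiftPositivity := by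
  rintro ⟨c, hc, hp⟩
  exact not_kernelTestSomeScale_of hneg ⟨c, hc, (kernelNecessity_iff.mp hN) c hc hp⟩

/-- Transfer break point, typed: the ratio test fails at EVERY scale (wanted negation of item 1520;
Bohr–Courant density of `log ζ` on `1/2 < σ < 1`, in tree as `BohrCourant1914_dense_holds`). -/
def RatioNegAll : Prop := ∀ c : ℝ, 0 < c → ∃ s : ℂ, 1 / 2 < s.re ∧ (ξ (s + 2 * c) / ξ s).re < 0

theorem not_ratioPosSomeScale_of (h : RatioNegAll) : ¬ RatioPosSomeScale := by
  rintro ⟨c, hc, hr⟩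
  obtain ⟨s, hs, hlt⟩ := h c (by linarith)
  have := hr s hs
  linarith

end

end Summit.RiemannHypothesis.RiemannHypothesis.Cruxes.ShiftPositivity.Census
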